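import Summits.Ventures.HodgeRepro2.Faces
import Summits.Ventures.HodgeRepro2.InducedTypeAssembly

/-!
# T6B4Interface — the B3 ↔ B4 interface of TIER4 §B4.0, as carrier-free Props (Tier 6, sub-goal B4)

Cell pub-hodge-repro2, Tier 6 FORMALIZE (README §10), sub-goal B4 «the orientation / sign
convention» (route/TIER4.md §B4 = route/T4-B4-p1.md v7, owner p1; Tier-6 owner t6-p7,
route/T6-B4-t6-p7.md). Statement lane: `def … : Prop` only, no theorem.

Carriers (the print's own algebraic objects; no abelian-variety carrier is needed to STATE them):
* `K` — the CM field `F` of the brief (a number field; Galois over ℚ where the inverse type is used);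
* `K →+* ℂ` — the set `Σ = Hom(F, ℂ)` of complex embeddings; `τ₁ : K →+* ℂ` the base embedding
  (Liu's fixed `τ′`, TIER4 §0 conventions);
* `Φμ : Set (K →+* ℂ)` — the CM type `Φ_μ ⊂ Σ` of the conjugate symplectic character `μ`
  (Liu 2021 Def. 4.3);
* `M : IntermediateField ℚ ℂ` — the number field `M̃_μ ⊆ ℂ` generated by the values of `μ^alg`
  (Liu 2021 p. 41 l. 45, journal letters);
* `Φt : (K →+* ℂ) → Set (M →+* ℂ)` — `τ′ ↦ Φ̃(τ′)`, the CM type of the `M̃_μ`-abelian variety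
  `A_μ ⊗_{E,τ′} ℂ` (TIER4 B4.0); the abelian variety itself is NOT a carrier here — only the
  function `τ′ ↦ Φ̃(τ′)` is, and the two Props below are the two facts B4 consumes about it.

These two Props are NOT displays of published theorems: they are the OUTPUTS of sub-claim B3
(TIER4 §B3(b) = (Eq) and §B3(d) = (D), owner p2 in Tier 4, t6-p6 in Tier 6), consumed by `B4_main`
(T6B4Main.lean) as explicit hypotheses, exactly as TIER4 §B4 «INTERFACE» consumes them.
-/

namespace Summit.Ventures.HodgeRepro2.T6.B4Interface

open Summit.Ventures.HodgeRepro2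

variable {K : Type*} [Field K]

/-- (Eq) — TIER4 §B4.0 INTERFACE, output of sub-claim B3(b) (Lange 2023 Prop. 1.1.9 is its printed
input there): «for every g ∈ Aut(ℂ): Φ̃(g ∘ τ′) = g ∘ Φ̃(τ′) := {g ∘ θ : θ ∈ Φ̃(τ′)}».
Here `Aut(ℂ) = (ℂ ≃+* ℂ)`, `g ∘ τ′ = (g : ℂ →+* ℂ).comp τ′`. (The clause «Φ̃(τ′) is a CM type of
M̃_μ» of (Eq) is not consumed by B4 and is not recorded here.) -/
def EqCompat (M : IntermediateField ℚ ℂ) (Φt : (K →+* ℂ) → Set (M →+* ℂ)) : Prop :=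
  ∀ (g : ℂ ≃+* ℂ) (τ' : K →+* ℂ),
    Φt ((g : ℂ →+* ℂ).comp τ') = (fun θ : M →+* ℂ => (g : ℂ →+* ℂ).comp θ) '' Φt τ'

/-- (D) — TIER4 §B4.0 INTERFACE, output of sub-claim B3(d) (Liu 2021 Def. 4.5(2) second bullet,
Rem. 4.2 and Shimura 1998 Prop. 19.10 are its printed inputs there), in the form «the inclusion
θ₀ : M̃_μ ⊂ ℂ lies in Φ̃(τ′) iff τ′ ∈ Φ_μ» (TIER4 B4.0: «equivalently (Lemma A0.5 for the CM field
M̃_μ)»). The inclusion `M̃_μ ⊂ ℂ` is `algebraMap M ℂ`. -/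
def HodgeDictionary (M : IntermediateField ℚ ℂ) (Φμ : Set (K →+* ℂ))
    (Φt : (K →+* ℂ) → Set (M →+* ℂ)) : Prop :=
  ∀ τ' : K →+* ℂ, algebraMap M ℂ ∈ Φt τ' ↔ τ' ∈ Φμ

/-- The conclusion of CLAIM (B4-I) as a Prop, in the form Lemma B4.4 consumes it: with `F` acting on
`A_μ ⊗_{τ₁} ℂ` through `F₁ = τ₁(F) ⊆ M̃_μ` (the `K`-algebra structure on `M` compatible with `τ₁`,
`hτ`), the CM type `Φ̃(τ₁)` of `M̃_μ` is the type INDUCED from `(F₁, Φ_μ⁻¹)`: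
`Φ̃(τ₁) = {θ : θ|_{F₁} ∘ τ₁ ∈ Φ_μ⁻¹}` — «the F-type of (A_μ ⊗_{τ₁} ℂ, ι) is r · Φ_μ⁻¹» with
`r = [M̃_μ : F₁]` the size of each fibre (`card_fibre`, InducedTypeSplitting.lean).
`inverseType K τ₁ Φμ` is the inverse type `Φ_μ⁻¹ = {τ₁ ∘ u⁻¹ : τ₁ ∘ u ∈ Φ_μ}` (Faces.lean),
`inducedSet T = {θ : M →+* ℂ | θ.comp (algebraMap K M) ∈ T}` (InducedTypeAssembly.lean). -/
def InverseTypeForced [NumberField K] [IsGalois ℚ K] (τ₁ : K →+* ℂ) (Φμ : Set (K →+* ℂ))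
    (M : IntermediateField ℚ ℂ) [Algebra K M] (Φt : (K →+* ℂ) → Set (M →+* ℂ)) : Prop :=
  Φt τ₁ = inducedSet (inverseType K τ₁ Φμ)


/-! §8(d) (README §8, declared per file at the request of t6-ref-1, STATUS l. 4307): uses an
L-value-free non-vanishing device: NO. (v2 = v1 + this declaration; every declaration byte-identical.) -/

end Summit.Ventures.HodgeRepro2.T6.B4Interface
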